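import Summits.MatrixMultiplication.MatrixMultiplication.Theses.ReesMunnRealization
import Summits.MatrixMultiplication.MatrixMultiplication.Theorems.CongruenceTowerPackingDegreeLeIndexAbelian

/-!
# `DegreeLeIndexAbelian` (route `ReesMunnRealization`) — character degrees are bounded by the
index of an abelian subgroup

Route `MatrixMultiplication/ReesMunnRealization`, item `stmt-MatrixMultiplication-18279` (support):
for a finite group `G`, an abelian subgroup `A ≤ G` and every `d ∈ charDegrees G` (the dimension of
an irreducible complex representation of `G`), `d ≤ [G : A]` (Isaacs, *Character Theory of Finite
Groups*, Problem 2.9(b); for normal `A` the easy half of Ito's theorem, ibid. Thm. 6.15).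

The statement is shared verbatim with route `CongruenceTowerPacking`
(item `stmt-MatrixMultiplication-12345`), where it is proved as
`Summit.MatrixMultiplication.MatrixMultiplication.Theorems.DegreeLeIndexAbelian_proof`
(common eigenvector of the commuting family `ρ(A)`, one translate per coset of `A`, irreducibility).
This file transports that theorem to the present route's declaration (the two `def`s are
definitionally equal).
-/

-- single-conjunct summit: the mandated namespace `Summit.MatrixMultiplication.MatrixMultiplication.…`
-- repeats `MatrixMultiplication` (summit = sub-problem), which `linter.dupNamespace` would flag.
set_option linter.dupNamespace false

namespace Summit.MatrixMultiplication.MatrixMultiplication.Theorems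

/-- **Character degrees are at most the index of any abelian subgroup** (settles
`stmt-MatrixMultiplication-18279`, exact route signature
`Summit.MatrixMultiplication.MatrixMultiplication.Theses.ReesMunnRealization.DegreeLeIndexAbelian`):
if `G` is a finite group, `A ≤ G` is abelian and `d ∈ charDegrees G`, then `d ≤ [G : A]`.
Obtained from the identical statement of route `CongruenceTowerPacking`
(`DegreeLeIndexAbelian_proof`). [cite: Isaacs1976, Problem 2.9(b)] -/
theorem reesMunn_degreeLeIndexAbelian_proof :
    Summit.MatrixMultiplication.MatrixMultiplication.Theses.ReesMunnRealization.DegreeLeIndexAbelian := by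
  unfold Summit.MatrixMultiplication.MatrixMultiplication.Theses.ReesMunnRealization.DegreeLeIndexAbelian
  exact DegreeLeIndexAbelian_proof

end Summit.MatrixMultiplication.MatrixMultiplication.Theorems
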